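/-
Copyright (c) 2026 the pub-hodgecm-mathlib formalisation cell (harness21).  Planner seat hodgecm-mathlib-LH4-plan (g3): half A line LH4, «DYADIC PAYDOWN SKELETON» v1
(desk F0P3-plan (g14) 2026-09-02T06:49:33Z); HOME-first candidate of the leaf `Cruxes/H413/Lines/F0_P3c_DyadicPaydown.lean` ED. 1 (written ONLY on the desk's word).
-/
import Literature.NumberTheory.Rogawski1990.LocalTransferIdentityCoreDyadicDescent   -- ★ p849813 (LH4-p03 (g4)): `n6nsDyadic_of_dyadicAntidiag` («DYADIC» ⟸ «DYADIC AT `Φ₃`»); brings ★ p847938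
import Literature.NumberTheory.Rogawski1990.ShalikaGermExpansionUnitaryThreeNonsplitCM   -- ★ p850283∕p850317 (LH10-p01 (g3), LH4 WORDS #22∕#23): `UnitaryGroup.shalikaGermExpansionNonsplit_antidiagOne_three` (Shalika at `Φ₃`, EVERY non-split place, in-house)
                                                                                     -- `N6nsDyadicStatement` (the row type BY NAME), ★ p847670 `ramificationIdx'_ne_one_of_not_isUnramifiedIn_of_subsingleton`
import Literature.NumberTheory.Rogawski1990.LocalTransferAtOneOfShalikaRankUnramifiedAll   -- ★ p853759 (LH4-p01 (g12)): `s3id_of_shalikaAntidiag_of_isUnramifiedIn` — (D-UNR) PAID at ED. 4 (2-free column: organ (I) ★ p853750, fold ★ p853755)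
import Literature.NumberTheory.Automorphic.LocalUnitaryGroupCongr                          -- ★ `UnitaryGroup.antidiagOne_isHermitian`, `UnitaryGroup.isUnit_antidiagOne_det` (`Φ₃` hermitian, `det Φ₃ ≠ 0`)
import HarnessLib

/-!
# h413 line LH4 — pay-down skeleton of the closer row `stub_N6nsDyadic : N6nsDyadicStatement` («DYADIC», [LS₂] at the places `v ∣ 2`)

Cell `pub/hodgecm-mathlib` (D-0151), crux H413 = `stmt-HodgeConjecture-24833`, route of record `HCCMUnconditional`; half A line LH4.  Closer
`Cruxes/H413/Lines/F0_U3LettersRung1.lean` (tree ED. 40) row `stub_N6ns : LocalTransferExplicitNonsplitClosed`; after closer ED. 39 §2‴ «α-odd-★» (germ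
`F0_P3a_N6nsGerm` ED. 1.17 binder `hdy : N6nsDyadicStatement`) the row's ONLY print residual at finite non-split places is
`stub_N6nsDyadic : Literature.NumberTheory.Rogawski1990.N6nsDyadicStatement` (★ p847938): the identity core of local `Δ‴_v`-transfer for `(U(H′), U(1,1) × U(1))` at the
DYADIC non-split places `v ∣ 2` of `L⁺`, for every CM field `L` and every anisotropic hermitian `H′ ∈ M₃(L)`.  HONEST LABEL: HC_CM is proved only modulo the 7 printed citations (2 remaining named inputs: hLiu418 = stmt-HodgeConjecture-24832, h413 = stmt-HodgeConjecture-24833) until rung 0 closes; this file is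
COUNT-NEUTRAL: it re-cuts one PRINT row into three smaller PRINT∕in-house organs and discharges nothing by itself.

## The cut (three organs, two proved heads; ≤ 5 organs, no organ restates the row)

Step 0 (★, parity-free, already in the tree): ★ p849813 `n6nsDyadic_of_dyadicAntidiag` narrows «DYADIC» to «DYADIC AT `Φ₃`» (frame ★ (H2) + DESCENT ★ `s3id_descent_of_formCongr`).
«DYADIC AT `Φ₃`» is then cut EXACTLY as ★ p847670 cuts the odd identity core (`n6nsS3id_of_tameRamAntidiag_of_dyadic_of_shalikaAntidiag`): Shalika germ expansion as a
separate organ, and the transfer identity GIVEN Shalika split by the inert∕ramified dichotomy at `v` (Mathlib `Algebra.IsUnramifiedIn`; ★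
`ramificationIdx'_ne_one_of_not_isUnramifiedIn_of_subsingleton`).

* (D-SH) `stub_DyShalika` — «SHALIKA AT `Φ₃`, DYADIC PLACES»: `ShalikaGermExpansionNonsplit L Φ₃ v` at every non-split `v` with `2 ∉ 𝒪_w^×` (= ★ p849113
  `N6nsShalikaOddStatement` with the single token `IsUnit (2 : 𝒪_w)` ↦ `¬ IsUnit (2 : 𝒪_w)`).  PRINT [Rogawski1990 Prop. 8.1.1] ∕ [HarishChandra1999 Thm. 8.1] (valid in every
  residue characteristic).  IN-HOUSE SIZE **L** (census `F0/P3c/LH4/LH4-p02/g2/DYADIC-CENSUS.v1.md` 78152befe20dff4e): ROAD = LEAF ED. 1 `F0_P3c_ShalikaPaydown`'s organ letters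
  with `IsUnit 2 ↦ ¬ IsUnit 2` — ‹U-FIN-dy› (unipotent classes at dyadic `w`: skew unit `δ = 2θ+1` at unramified `w`; wild `w` needs the norm-index-2 input (b1)), ‹RAO-dy›
  (singular classes ★ p849351 are ALREADY dyadic; regular class: the `c₂ := ord_w 2` re-type of ★ (A2)∕(I)∕(II-C)∕(II), brick (R-dy)), ‹DUAL-dy› (dual pieces; the odd proof uses
  `2 ∈ 𝒪^×` through the Jacobowitz lattice normal form — wild case (b2)), ‹SPAN› (★ SPAN-e is parity-free), plug ★ p848172 `shalikaGermExpansionNonsplit_of_howePackage` (parity-free).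
* (D-UNR) `stub_DyUnramCore` — «[LS₂] AT `Φ₃`, DYADIC UNRAMIFIED, GIVEN SHALIKA»: the identity `SO_{γH}(φH) = Σ_c Δ‴_v(γH, c)·O_c(φ₃)` near `1` for every
  `φ₃ ∈ C_c^∞(U(Φ₃)(L⁺_v))`, at a non-split `v ∣ 2` UNRAMIFIED in `L` (= ★ `N6nsS3ramStatement` with `e(w|v) ≠ 1` ↦ `Algebra.IsUnramifiedIn (𝓞 L) v` and `2 ∈ 𝒪_w^×` ↦
  `2 ∉ 𝒪_w^×`; the Shalika hypothesis line KEPT, fed by (D-SH)).  PRINT [LS₂] = [LanglandsShelstad1989, Thm. p. 484] via [Rogawski1990 Prop. 4.9.1 (a)].  IN-HOUSE SIZE **XL**: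
  ROAD = the hyperspecial column of the odd proof (★ `s3id_of_shalikaAntidiag`: μ-twist (H1–T4) + RANK ★ `exists_levelPieces_det_classOrbitalIntegral_ne_zero` + level-≤-2 pieces
  ★ `localTransferAtOne_of_hyperspecialLevel_le_two` + germ fold ★ `localTransferAtOne_of_germExpansion`); the germ fold and the μ-twist are parity-free, RANK and the
  depth-zero piece transfer (Cayley shifts, `q ≡ 1 (2)` steps) are NOT — residue characteristic 2 is a genuine recomputation, not a token swap.
  **PAID at ED. 4** by ★ p853759 `s3id_of_shalikaAntidiag_of_isUnramifiedIn` (the recomputation done: 2-free RANK′, 2-free depth-zero pieces via the hermitian Cayley shift `φ_θ`,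
  organ (I) ★ p853750 + level-two fold ★ p853755; M6 hands LH4-p01 (g11∕g12), LH10-p01 (g12∕g13), LH7-p04 (g13)).
* (D-RAM) `stub_DyRamCore` — «[LS₂] AT `Φ₃`, DYADIC RAMIFIED (WILD), GIVEN SHALIKA»: the same identity at a non-split `v ∣ 2` RAMIFIED in `L` (= ★ `N6nsS3ramStatement` with the
  single token `IsUnit (2 : 𝒪_w)` ↦ `¬ IsUnit (2 : 𝒪_w)`).  PRINT [LS₂].  IN-HOUSE SIZE **XL+**: the tame-ramified fold's frame (skew uniformiser, `E_w = F_v(√ϖ)`) fails for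
  WILD quadratic `E_w∕F_v`; needs (b1) LCFT norm index 2 for wild `E_w∕F_v` and (b2) wild hermitian lattice classification (census (b1)(b2)) before any column can be re-run.

HEADS (PROVED, no `sorry` outside the three organs): `n6nsDyadic_of_organs : (D-SH) → (D-UNR) → (D-RAM) → N6nsDyadicStatement` (★ p849813 + `Subsingleton` from
`c • w = w` ★ `UnitaryGroup.PlacesOver.subsingleton_of_smul_eq` + the dichotomy `by_cases Algebra.IsUnramifiedIn (𝓞 L) v`) and the PAID HEAD BY NAME
`stub_N6nsDyadic_paid : Literature.NumberTheory.Rogawski1990.N6nsDyadicStatement := n6nsDyadic_of_organs stub_DyShalika stub_DyUnramCore stub_DyRamCore`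
(`--axioms` = TRIO ∪ {sorryAx} through EXACTLY `stub_DyRamCore` at ED. 4; through the three `stub_Dy*` at ED. 1).  Why this cut and not «RANK + pieces at level ≤ 2, dyadic»: the piece class that separates the unipotent
classes at residue characteristic 2 is not known to be level ≤ 2 (census §2, §5) — an organ pinning it could be FALSE; the three organs above are TRUE by print as typed.

NOT IN THIS FILE (honest): no in-house payment of organ (D-RAM); no `instance`, no `def`, no notation; never imported by a sorry-free file (T11-93); books count-neutral until a
desk edition of the closer∕germ consumes `stub_N6nsDyadic_paid` (socket: germ ED. 1.17 binder `hdy`, by `exact`).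

EDITION LOG.  ED. 1 (2026-09-02T07:07Z, a78d34cdd4c5): three PRINT organs (D-SH)(D-UNR)(D-RAM), heads proved.  ED. 2 «(D-SH) ↦ WILD» (cand 985ff04f47d2ffbd, boxed GREEN) was
SKIPPED by desk ruling D74′ (F0P3-plan (g14) 2026-09-02T07:46:39Z, RULE (β)).  ED. 3 «(D-SH) PROVED» (2026-09-02T07:54Z, d06031a7ab59baf2): the organ `stub_DyShalika` is now a THEOREM, by the bare name
★ p850317 `UnitaryGroup.shalikaGermExpansionNonsplit_antidiagOne_three` (Shalika germ expansion at `Φ₃` at EVERY non-split place, hypothesis-free; = ★ p850283 `…_of_dualPieces` fed with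
★ p850291 `…exists_unipotentDualPieces_antidiagOne_nonsplit`, over ‹U-FIN› ★ p850231, ‹RAO› ★ p850112, ‹SPAN› ★ p850263, ‹DUAL› ★ p850268; LH4 dealer board, hands LH10-p01 (g3),
LH5-p03 (g2), A-p12 (g26), F0P3a-p04 (g22), F0P3a-p07 (g16), LH4-p02 (g3)); code-`sorry` 3 → 2; `--axioms stub_DyShalika` = TRIO, `--axioms stub_N6nsDyadic_paid` = TRIO ∪ {sorryAx}
through EXACTLY `stub_DyUnramCore`, `stub_DyRamCore` (the two [LS₂] identity cores, PRINT; priced by F0P3a-p06 (g17)'s h2-census OUTCOME B: wild quadratic conductor wall).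
**ED. 4 «(D-UNR) PROVED» (this text)**: the organ `stub_DyUnramCore` is now a THEOREM, by the bare name ★ p853759 `s3id_of_shalikaAntidiag_of_isUnramifiedIn` at `H′ = Φ₃`
(LH4-p01 (g12); 2-free hyperspecial column over organ (I) ★ p853750 and the level-two fold ★ p853755, LEAD F0P3a-plan T15-55 «GO-LOW, φ_θ everywhere»; CM-glue ∕ BINDERS-θ ∕ centre
bricks by LH4-p01 (g11∕g12), LH10-p01 (g12∕g13), LH7-p04 (g13)); code-`sorry` 2 → 1; `--axioms stub_DyUnramCore` = TRIO, `--axioms stub_N6nsDyadic_paid` = TRIO ∪ {sorryAx} through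
EXACTLY `stub_DyRamCore` (the WILD RAMIFIED [LS₂] identity core, PRINT, XL+).  A Summits twin `Theorems/F0P3cDyUnramCore.lean :: dyUnramCore` carries the same organ text sorry-free.
The ED. 1 sentences above about «three organs» are superseded accordingly; statement texts of all organs and heads are byte-identical to ED. 1.

## References
* [Rogawski1990] J. D. Rogawski, *Automorphic Representations of Unitary Groups in Three Variables*, Ann. of Math. Stud. 123 (1990): §4.9 Prop. 4.9.1 (a) p. 55 («the
  existence of `f^H` in the p-adic case is contained in [LS₂]»); §8.1 Props. 8.1.1–8.1.2 pp. 112–114 (Shalika germs, any residue characteristic); §14.4 p. 237.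
* [LanglandsShelstad1989] R. P. Langlands, D. Shelstad, *Orbital integrals on forms of SL(3), II*, Canad. J. Math. 41 (1989) 480–507: Theorem (end of §2, p. 484) (= [LS₂];
  no restriction on the residue characteristic).
* [LanglandsShelstad1990Descent] R. P. Langlands, D. Shelstad, *Descent for transfer factors*, The Grothendieck Festschrift II, Progr. Math. 87 (1990): §2.1 (2.1.2).
* [HarishChandra1999AdmissibleDistributions] Harish-Chandra (notes by S. DeBacker, P. J. Sally Jr.), *Admissible invariant distributions on reductive p-adic groups*,
  Univ. Lecture Ser. 16, AMS (1999): Thm. 8.1 p. 48 (Shalika germ expansion, arbitrary residue characteristic).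
* [NeukirchANT1999] J. Neukirch, *Algebraic Number Theory*, Grundlehren 322 (1999): Ch. I §8 (inert∕ramified dichotomy at a non-split prime).
-/

set_option autoImplicit false
set_option linter.dupNamespace false
set_option linter.unusedVariables false

noncomputable section

namespace Summit.HodgeConjecture.HodgeConjecture.Cruxes.H413.F0P3cDyadicPaydown

open MeasureTheory Measure NumberField IsDedekindDomain Topology Filter
open Literature.NumberTheory.Automorphic Literature.NumberTheory.Automorphic.UnitaryGroup Literature.NumberTheory.Automorphic.IntegralReduction
open Literature.NumberTheory.Rogawski1990 Literature.NumberTheory.GaloisRepresentations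
open scoped Matrix MatrixGroups Classical ValuativeRel

/-! ## §1 The three organs (DYADIC non-split places) -/

/-- **ORGAN (D-SH) `stub_DyShalika` — PROVED at ED. 3** (was the PRINT organ of ED. 1): the Shalika germ expansion at the identity for the quasi-split `U(Φ₃)(L⁺_v)` at every
non-split place `v` with `2 ∉ 𝒪_w^×` (= ★ `N6nsShalikaOddStatement` with `IsUnit 2 ↦ ¬ IsUnit 2`), by the in-house all-places theorem ★ p850317 `UnitaryGroup.shalikaGermExpansionNonsplit_antidiagOne_three`
(LH10-p01 (g3); = ★ p850283 `…_of_dualPieces` fed with ★ p850291 `UnitaryGroup.exists_unipotentDualPieces_antidiagOne_nonsplit`, F0P3a-p04 (g22)) over tonight's LH4 board: ‹U-FIN› ★ p850143∕p850209∕p850231 (LH5-p03, LH10-p01; Hensel (W-a) ★ p850199, norm classes (W-b) ★ p850190∕p850215), ‹RAO› ★ p850047∕48∕75∕p850112 (LH10-p01),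
‹SPAN› ★ p850139∕p850186∕p850263 (A-p12 (g26)), ‹DUAL› ★ p850074∕p850106∕p850268 + `…DualPiecesAllCM` (F0P3a-p04 (g22); census F0P3a-p07 (g16)), assemblies ★ p850226 (LH5-p03) ∕ p850283 + ED. 2 (LH10-p01).
Its TYPE is unchanged from ED. 1, so the heads `n6nsDyadic_of_organs` ∕ `stub_N6nsDyadic_paid` are untouched; the `¬ IsUnit 2` binder is now unused (kept for the head's text).
[cite: Rogawski1990, §8.1 Prop. 8.1.1 p. 112] [cite: HarishChandra1999AdmissibleDistributions, Thm. 8.1 p. 48] -/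
theorem stub_DyShalika :
    ∀ (L : Type) [Field L] [NumberField L] [IsCMField L] (v : HeightOneSpectrum (𝓞 ↥(maximalRealSubfield L))) (w : UnitaryGroup.PlacesOver L v),
      Subsingleton (UnitaryGroup.PlacesOver L v) → ¬ IsUnit (2 : 𝒪[w.1.adicCompletion L]) →
        ShalikaGermExpansionNonsplit L (Matrix.of fun i j : Fin 3 => if i.val + j.val + 1 = 3 then (1 : L) else 0) v :=
  fun L _ _ _ v w hsub _ => UnitaryGroup.shalikaGermExpansionNonsplit_antidiagOne_three L v w hsub

set_option maxHeartbeats 400000 in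
-- statement-heavy: letter-sized organ text
/-- **ORGAN (D-UNR) `stub_DyUnramCore` — PROVED at ED. 4** (was the PRINT [LS₂] organ of ED. 1–3; in-house XL, PAID) — the identity core of local `Δ‴_v`-transfer for the quasi-split form `Φ₃`, GIVEN the Shalika germ expansion, at a
non-split DYADIC place `v` (`2 ∉ 𝒪_w^×`) that is UNRAMIFIED in `L` (= ★ `N6nsS3ramStatement` with `e(w|v) ≠ 1 ↦ Algebra.IsUnramifiedIn (𝓞 L) v`, `IsUnit 2 ↦ ¬ IsUnit 2`).
PROOF (ED. 4): the bare name ★ p853759 `s3id_of_shalikaAntidiag_of_isUnramifiedIn` (LH4-p01 (g12)) at `H′ = Φ₃` — the 2-free hyperspecial column: μ-twist ★ (H1-T4), frame ★ (H2),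
descent ★ `s3id_descent_of_formCongr`, RANK′ ★ `exists_levelPieces_det_classOrbitalIntegral_ne_zero'`, level-two fold ★ p853755 `localTransferAtOne_of_hyperspecialLevel_le_two_of_isUnramifiedIn`
over organ (I) ★ p853750 `liftInterior_of_levelTwo_of_isUnramifiedIn` (hermitian Cayley shift `φ_θ`, `θ + σθ = 1`, Eisenstein-centre currency at type-(2) elements; LEAD T15-55).
Its TYPE is unchanged from ED. 1, so the heads are untouched; the binders `_hμu`, `_h2 : ¬ IsUnit 2` are unused (the road is uniform in the residue characteristic).
[cite: LanglandsShelstad1989, Thm. p. 484] [cite: Rogawski1990, §4.9 Prop. 4.9.1 (a) p. 55] -/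
theorem stub_DyUnramCore :
    ∀ (L : Type) [Field L] [NumberField L] [IsCMField L] (μ : HeckeCharacter L)
      {v : HeightOneSpectrum (𝓞 ↥(maximalRealSubfield L))} (w : UnitaryGroup.PlacesOver L v)
      (_hw : IsCMField.complexConj L • w.1 = w.1) (_hv : Algebra.IsUnramifiedIn (𝓞 L) v.asIdeal)
      (_hμu : μ.IsUnitary)
      (_hμω : ∀ x : ideleGroup ↥(maximalRealSubfield L), μ (AdeleRing.ideleBaseChange ↥(maximalRealSubfield L) L x) = quadraticHeckeCharCM L x)
      (_h2 : ¬ IsUnit (2 : 𝒪[w.1.adicCompletion L]))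
      [MeasurableSpace ((UnitaryGroup.cmDatum L 3 (Matrix.of fun i j : Fin 3 => if i.val + j.val + 1 = 3 then (1 : L) else 0)).Local v)] [BorelSpace ((UnitaryGroup.cmDatum L 3 (Matrix.of fun i j : Fin 3 => if i.val + j.val + 1 = 3 then (1 : L) else 0)).Local v)]
      [∀ γ : ((UnitaryGroup.cmDatum L 3 (Matrix.of fun i j : Fin 3 => if i.val + j.val + 1 = 3 then (1 : L) else 0)).Local v), MeasurableSpace (((UnitaryGroup.cmDatum L 3 (Matrix.of fun i j : Fin 3 => if i.val + j.val + 1 = 3 then (1 : L) else 0)).Local v) ⧸ Subgroup.centralizer ({γ} : Set ((UnitaryGroup.cmDatum L 3 (Matrix.of fun i j : Fin 3 => if i.val + j.val + 1 = 3 then (1 : L) else 0)).Local v)))]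
      [∀ γ : ((UnitaryGroup.cmDatum L 3 (Matrix.of fun i j : Fin 3 => if i.val + j.val + 1 = 3 then (1 : L) else 0)).Local v), BorelSpace (((UnitaryGroup.cmDatum L 3 (Matrix.of fun i j : Fin 3 => if i.val + j.val + 1 = 3 then (1 : L) else 0)).Local v) ⧸ Subgroup.centralizer ({γ} : Set ((UnitaryGroup.cmDatum L 3 (Matrix.of fun i j : Fin 3 => if i.val + j.val + 1 = 3 then (1 : L) else 0)).Local v)))]
      [MeasurableSpace ((UnitaryGroup.cmDatum L 2 (Matrix.of fun i j : Fin 2 => if i.val + j.val + 1 = 2 then (1 : L) else 0)).Local v × (UnitaryGroup.cmDatum L 1 (Matrix.of fun i j : Fin 1 => if i.val + j.val + 1 = 1 then (1 : L) else 0)).Local v)] [BorelSpace ((UnitaryGroup.cmDatum L 2 (Matrix.of fun i j : Fin 2 => if i.val + j.val + 1 = 2 then (1 : L) else 0)).Local v × (UnitaryGroup.cmDatum L 1 (Matrix.of fun i j : Fin 1 => if i.val + j.val + 1 = 1 then (1 : L) else 0)).Local v)]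
      [∀ a : ((UnitaryGroup.cmDatum L 2 (Matrix.of fun i j : Fin 2 => if i.val + j.val + 1 = 2 then (1 : L) else 0)).Local v × (UnitaryGroup.cmDatum L 1 (Matrix.of fun i j : Fin 1 => if i.val + j.val + 1 = 1 then (1 : L) else 0)).Local v), MeasurableSpace (((UnitaryGroup.cmDatum L 2 (Matrix.of fun i j : Fin 2 => if i.val + j.val + 1 = 2 then (1 : L) else 0)).Local v × (UnitaryGroup.cmDatum L 1 (Matrix.of fun i j : Fin 1 => if i.val + j.val + 1 = 1 then (1 : L) else 0)).Local v) ⧸ Subgroup.centralizer ({a} : Set ((UnitaryGroup.cmDatum L 2 (Matrix.of fun i j : Fin 2 => if i.val + j.val + 1 = 2 then (1 : L) else 0)).Local v × (UnitaryGroup.cmDatum L 1 (Matrix.of fun i j : Fin 1 => if i.val + j.val + 1 = 1 then (1 : L) else 0)).Local v)))]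
      [∀ a : ((UnitaryGroup.cmDatum L 2 (Matrix.of fun i j : Fin 2 => if i.val + j.val + 1 = 2 then (1 : L) else 0)).Local v × (UnitaryGroup.cmDatum L 1 (Matrix.of fun i j : Fin 1 => if i.val + j.val + 1 = 1 then (1 : L) else 0)).Local v), BorelSpace (((UnitaryGroup.cmDatum L 2 (Matrix.of fun i j : Fin 2 => if i.val + j.val + 1 = 2 then (1 : L) else 0)).Local v × (UnitaryGroup.cmDatum L 1 (Matrix.of fun i j : Fin 1 => if i.val + j.val + 1 = 1 then (1 : L) else 0)).Local v) ⧸ Subgroup.centralizer ({a} : Set ((UnitaryGroup.cmDatum L 2 (Matrix.of fun i j : Fin 2 => if i.val + j.val + 1 = 2 then (1 : L) else 0)).Local v × (UnitaryGroup.cmDatum L 1 (Matrix.of fun i j : Fin 1 => if i.val + j.val + 1 = 1 then (1 : L) else 0)).Local v)))]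
      (νH : Measure ((UnitaryGroup.cmDatum L 2 (Matrix.of fun i j : Fin 2 => if i.val + j.val + 1 = 2 then (1 : L) else 0)).Local v × (UnitaryGroup.cmDatum L 1 (Matrix.of fun i j : Fin 1 => if i.val + j.val + 1 = 1 then (1 : L) else 0)).Local v)) [νH.IsHaarMeasure] [νH.IsMulRightInvariant]
      (νG₃ : Measure ((UnitaryGroup.cmDatum L 3 (Matrix.of fun i j : Fin 3 => if i.val + j.val + 1 = 3 then (1 : L) else 0)).Local v)) [νG₃.IsHaarMeasure] [νG₃.IsMulRightInvariant]
      {mH : OrbitalMeasureFamily ((UnitaryGroup.cmDatum L 2 (Matrix.of fun i j : Fin 2 => if i.val + j.val + 1 = 2 then (1 : L) else 0)).Local v × (UnitaryGroup.cmDatum L 1 (Matrix.of fun i j : Fin 1 => if i.val + j.val + 1 = 1 then (1 : L) else 0)).Local v)} {mG₃ : OrbitalMeasureFamily ((UnitaryGroup.cmDatum L 3 (Matrix.of fun i j : Fin 3 => if i.val + j.val + 1 = 3 then (1 : L) else 0)).Local v)},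
      mH.IsCanonical (IsLocalGRegular L v) νH → mG₃.IsCanonical (fun γ => IsRegularElt (γ.val : GL (Fin 3) (UnitaryGroup.LocalRing L v))) νG₃ →
      ShalikaGermExpansionNonsplit L (Matrix.of fun i j : Fin 3 => if i.val + j.val + 1 = 3 then (1 : L) else 0) v →
      ∀ (φ₃ : ((UnitaryGroup.cmDatum L 3 (Matrix.of fun i j : Fin 3 => if i.val + j.val + 1 = 3 then (1 : L) else 0)).Local v) → ℂ), IsLocSmooth φ₃ →
        ∃ V ∈ 𝓝 (1 : ((UnitaryGroup.cmDatum L 2 (Matrix.of fun i j : Fin 2 => if i.val + j.val + 1 = 2 then (1 : L) else 0)).Local v × (UnitaryGroup.cmDatum L 1 (Matrix.of fun i j : Fin 1 => if i.val + j.val + 1 = 1 then (1 : L) else 0)).Local v)), ∃ φH : ((UnitaryGroup.cmDatum L 2 (Matrix.of fun i j : Fin 2 => if i.val + j.val + 1 = 2 then (1 : L) else 0)).Local v × (UnitaryGroup.cmDatum L 1 (Matrix.of fun i j : Fin 1 => if i.val + j.val + 1 = 1 then (1 : L) else 0)).Local v) → ℂ, IsLocSmooth φH ∧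
          ∀ γH ∈ V, IsLocalGRegular L v γH →
            stableOrbitalIntegralRel (IsLocalStablyConjH L v) mH φH γH =
              ∑ᶠ c : ConjClasses ((UnitaryGroup.cmDatum L 3 (Matrix.of fun i j : Fin 3 => if i.val + j.val + 1 = 3 then (1 : L) else 0)).Local v), ((finExplicitCollection L (Matrix.of fun i j : Fin 3 => if i.val + j.val + 1 = 3 then (1 : L) else 0) μ (finExplicitDelta_conj_left_all L (Matrix.of fun i j : Fin 3 => if i.val + j.val + 1 = 3 then (1 : L) else 0) μ) (finExplicitDelta_conj_right_all L (Matrix.of fun i j : Fin 3 => if i.val + j.val + 1 = 3 then (1 : L) else 0) μ)) v).Δ γH (Quotient.out c) * classOrbitalIntegral mG₃ φ₃ c :=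
  fun L _ _ _ μ _ w hw hv _ hμω _ _ _ _ _ _ _ _ _ νH _ _ νG₃ _ _ _ _ hmH hmG₃ hSh φ₃ hφ₃ =>
    s3id_of_shalikaAntidiag_of_isUnramifiedIn L (Matrix.of fun i j : Fin 3 => if i.val + j.val + 1 = 3 then (1 : L) else 0) μ
      (UnitaryGroup.antidiagOne_isHermitian L 3) (UnitaryGroup.isUnit_antidiagOne_det L 3).ne_zero w hw hv hμω νH νG₃ hmH hmG₃ hSh φ₃ hφ₃

set_option maxHeartbeats 400000 in
-- statement-heavy: letter-sized organ text
/-- **ORGAN (D-RAM) `stub_DyRamCore` (PRINT [LS₂]; in-house XL+)** — the identity core of local `Δ‴_v`-transfer for the quasi-split form `Φ₃`, GIVEN the Shalika germ expansion, at a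
non-split DYADIC place `v` (`2 ∉ 𝒪_w^×`) that is RAMIFIED in `L` (`e(w|v) ≠ 1`, necessarily wild) (= ★ `N6nsS3ramStatement` with the single token `IsUnit 2 ↦ ¬ IsUnit 2`).
[cite: LanglandsShelstad1989, Thm. p. 484] [cite: Rogawski1990, §4.9 Prop. 4.9.1 (a) p. 55] -/
theorem stub_DyRamCore :
    ∀ (L : Type) [Field L] [NumberField L] [IsCMField L] (μ : HeckeCharacter L)
      {v : HeightOneSpectrum (𝓞 ↥(maximalRealSubfield L))} (w : UnitaryGroup.PlacesOver L v)
      (_hw : IsCMField.complexConj L • w.1 = w.1) (_he : v.asIdeal.ramificationIdx' w.1.asIdeal ≠ 1)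
      (_hμu : μ.IsUnitary)
      (_hμω : ∀ x : ideleGroup ↥(maximalRealSubfield L), μ (AdeleRing.ideleBaseChange ↥(maximalRealSubfield L) L x) = quadraticHeckeCharCM L x)
      (_h2 : ¬ IsUnit (2 : 𝒪[w.1.adicCompletion L]))
      [MeasurableSpace ((UnitaryGroup.cmDatum L 3 (Matrix.of fun i j : Fin 3 => if i.val + j.val + 1 = 3 then (1 : L) else 0)).Local v)] [BorelSpace ((UnitaryGroup.cmDatum L 3 (Matrix.of fun i j : Fin 3 => if i.val + j.val + 1 = 3 then (1 : L) else 0)).Local v)]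
      [∀ γ : ((UnitaryGroup.cmDatum L 3 (Matrix.of fun i j : Fin 3 => if i.val + j.val + 1 = 3 then (1 : L) else 0)).Local v), MeasurableSpace (((UnitaryGroup.cmDatum L 3 (Matrix.of fun i j : Fin 3 => if i.val + j.val + 1 = 3 then (1 : L) else 0)).Local v) ⧸ Subgroup.centralizer ({γ} : Set ((UnitaryGroup.cmDatum L 3 (Matrix.of fun i j : Fin 3 => if i.val + j.val + 1 = 3 then (1 : L) else 0)).Local v)))]
      [∀ γ : ((UnitaryGroup.cmDatum L 3 (Matrix.of fun i j : Fin 3 => if i.val + j.val + 1 = 3 then (1 : L) else 0)).Local v), BorelSpace (((UnitaryGroup.cmDatum L 3 (Matrix.of fun i j : Fin 3 => if i.val + j.val + 1 = 3 then (1 : L) else 0)).Local v) ⧸ Subgroup.centralizer ({γ} : Set ((UnitaryGroup.cmDatum L 3 (Matrix.of fun i j : Fin 3 => if i.val + j.val + 1 = 3 then (1 : L) else 0)).Local v)))]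
      [MeasurableSpace ((UnitaryGroup.cmDatum L 2 (Matrix.of fun i j : Fin 2 => if i.val + j.val + 1 = 2 then (1 : L) else 0)).Local v × (UnitaryGroup.cmDatum L 1 (Matrix.of fun i j : Fin 1 => if i.val + j.val + 1 = 1 then (1 : L) else 0)).Local v)] [BorelSpace ((UnitaryGroup.cmDatum L 2 (Matrix.of fun i j : Fin 2 => if i.val + j.val + 1 = 2 then (1 : L) else 0)).Local v × (UnitaryGroup.cmDatum L 1 (Matrix.of fun i j : Fin 1 => if i.val + j.val + 1 = 1 then (1 : L) else 0)).Local v)]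
      [∀ a : ((UnitaryGroup.cmDatum L 2 (Matrix.of fun i j : Fin 2 => if i.val + j.val + 1 = 2 then (1 : L) else 0)).Local v × (UnitaryGroup.cmDatum L 1 (Matrix.of fun i j : Fin 1 => if i.val + j.val + 1 = 1 then (1 : L) else 0)).Local v), MeasurableSpace (((UnitaryGroup.cmDatum L 2 (Matrix.of fun i j : Fin 2 => if i.val + j.val + 1 = 2 then (1 : L) else 0)).Local v × (UnitaryGroup.cmDatum L 1 (Matrix.of fun i j : Fin 1 => if i.val + j.val + 1 = 1 then (1 : L) else 0)).Local v) ⧸ Subgroup.centralizer ({a} : Set ((UnitaryGroup.cmDatum L 2 (Matrix.of fun i j : Fin 2 => if i.val + j.val + 1 = 2 then (1 : L) else 0)).Local v × (UnitaryGroup.cmDatum L 1 (Matrix.of fun i j : Fin 1 => if i.val + j.val + 1 = 1 then (1 : L) else 0)).Local v)))]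
      [∀ a : ((UnitaryGroup.cmDatum L 2 (Matrix.of fun i j : Fin 2 => if i.val + j.val + 1 = 2 then (1 : L) else 0)).Local v × (UnitaryGroup.cmDatum L 1 (Matrix.of fun i j : Fin 1 => if i.val + j.val + 1 = 1 then (1 : L) else 0)).Local v), BorelSpace (((UnitaryGroup.cmDatum L 2 (Matrix.of fun i j : Fin 2 => if i.val + j.val + 1 = 2 then (1 : L) else 0)).Local v × (UnitaryGroup.cmDatum L 1 (Matrix.of fun i j : Fin 1 => if i.val + j.val + 1 = 1 then (1 : L) else 0)).Local v) ⧸ Subgroup.centralizer ({a} : Set ((UnitaryGroup.cmDatum L 2 (Matrix.of fun i j : Fin 2 => if i.val + j.val + 1 = 2 then (1 : L) else 0)).Local v × (UnitaryGroup.cmDatum L 1 (Matrix.of fun i j : Fin 1 => if i.val + j.val + 1 = 1 then (1 : L) else 0)).Local v)))]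
      (νH : Measure ((UnitaryGroup.cmDatum L 2 (Matrix.of fun i j : Fin 2 => if i.val + j.val + 1 = 2 then (1 : L) else 0)).Local v × (UnitaryGroup.cmDatum L 1 (Matrix.of fun i j : Fin 1 => if i.val + j.val + 1 = 1 then (1 : L) else 0)).Local v)) [νH.IsHaarMeasure] [νH.IsMulRightInvariant]
      (νG₃ : Measure ((UnitaryGroup.cmDatum L 3 (Matrix.of fun i j : Fin 3 => if i.val + j.val + 1 = 3 then (1 : L) else 0)).Local v)) [νG₃.IsHaarMeasure] [νG₃.IsMulRightInvariant]
      {mH : OrbitalMeasureFamily ((UnitaryGroup.cmDatum L 2 (Matrix.of fun i j : Fin 2 => if i.val + j.val + 1 = 2 then (1 : L) else 0)).Local v × (UnitaryGroup.cmDatum L 1 (Matrix.of fun i j : Fin 1 => if i.val + j.val + 1 = 1 then (1 : L) else 0)).Local v)} {mG₃ : OrbitalMeasureFamily ((UnitaryGroup.cmDatum L 3 (Matrix.of fun i j : Fin 3 => if i.val + j.val + 1 = 3 then (1 : L) else 0)).Local v)},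
      mH.IsCanonical (IsLocalGRegular L v) νH → mG₃.IsCanonical (fun γ => IsRegularElt (γ.val : GL (Fin 3) (UnitaryGroup.LocalRing L v))) νG₃ →
      ShalikaGermExpansionNonsplit L (Matrix.of fun i j : Fin 3 => if i.val + j.val + 1 = 3 then (1 : L) else 0) v →
      ∀ (φ₃ : ((UnitaryGroup.cmDatum L 3 (Matrix.of fun i j : Fin 3 => if i.val + j.val + 1 = 3 then (1 : L) else 0)).Local v) → ℂ), IsLocSmooth φ₃ →
        ∃ V ∈ 𝓝 (1 : ((UnitaryGroup.cmDatum L 2 (Matrix.of fun i j : Fin 2 => if i.val + j.val + 1 = 2 then (1 : L) else 0)).Local v × (UnitaryGroup.cmDatum L 1 (Matrix.of fun i j : Fin 1 => if i.val + j.val + 1 = 1 then (1 : L) else 0)).Local v)), ∃ φH : ((UnitaryGroup.cmDatum L 2 (Matrix.of fun i j : Fin 2 => if i.val + j.val + 1 = 2 then (1 : L) else 0)).Local v × (UnitaryGroup.cmDatum L 1 (Matrix.of fun i j : Fin 1 => if i.val + j.val + 1 = 1 then (1 : L) else 0)).Local v) → ℂ, IsLocSmooth φH ∧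
          ∀ γH ∈ V, IsLocalGRegular L v γH →
            stableOrbitalIntegralRel (IsLocalStablyConjH L v) mH φH γH =
              ∑ᶠ c : ConjClasses ((UnitaryGroup.cmDatum L 3 (Matrix.of fun i j : Fin 3 => if i.val + j.val + 1 = 3 then (1 : L) else 0)).Local v), ((finExplicitCollection L (Matrix.of fun i j : Fin 3 => if i.val + j.val + 1 = 3 then (1 : L) else 0) μ (finExplicitDelta_conj_left_all L (Matrix.of fun i j : Fin 3 => if i.val + j.val + 1 = 3 then (1 : L) else 0) μ) (finExplicitDelta_conj_right_all L (Matrix.of fun i j : Fin 3 => if i.val + j.val + 1 = 3 then (1 : L) else 0) μ)) v).Δ γH (Quotient.out c) * classOrbitalIntegral mG₃ φ₃ c := by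
  sorry

/-! ## §2 The heads (PROVED) -/

set_option maxHeartbeats 800000 in
-- statement-heavy: three letter-sized organ texts as hypotheses
/-- **HEAD `n6nsDyadic_of_organs` (PROVED): (D-SH) → (D-UNR) → (D-RAM) → «DYADIC»** (= ★ `N6nsDyadicStatement` BY NAME): ★ p849813 `n6nsDyadic_of_dyadicAntidiag` reduces to
«DYADIC AT `Φ₃`» at `(L, μ, w)`; there `Subsingleton (PlacesOver L v)` from `c • w = w` (★ `UnitaryGroup.PlacesOver.subsingleton_of_smul_eq`), the Shalika expansion from (D-SH),
and the dichotomy `Algebra.IsUnramifiedIn (𝓞 L) v` ∕ `e(w|v) ≠ 1` (★ `ramificationIdx'_ne_one_of_not_isUnramifiedIn_of_subsingleton`) dispatches to (D-UNR) ∕ (D-RAM) — the proof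
pattern of ★ p847670 verbatim.
[cite: Rogawski1990, §4.9 Prop. 4.9.1 (a) p. 55] [cite: LanglandsShelstad1990Descent, §2.1 (2.1.2)] [cite: NeukirchANT1999, Ch. I §8] -/
theorem n6nsDyadic_of_organs
    (hsh :
    ∀ (L : Type) [Field L] [NumberField L] [IsCMField L] (v : HeightOneSpectrum (𝓞 ↥(maximalRealSubfield L))) (w : UnitaryGroup.PlacesOver L v),
      Subsingleton (UnitaryGroup.PlacesOver L v) → ¬ IsUnit (2 : 𝒪[w.1.adicCompletion L]) →
        ShalikaGermExpansionNonsplit L (Matrix.of fun i j : Fin 3 => if i.val + j.val + 1 = 3 then (1 : L) else 0) v)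
    (hunr :
    ∀ (L : Type) [Field L] [NumberField L] [IsCMField L] (μ : HeckeCharacter L)
      {v : HeightOneSpectrum (𝓞 ↥(maximalRealSubfield L))} (w : UnitaryGroup.PlacesOver L v)
      (_hw : IsCMField.complexConj L • w.1 = w.1) (_hv : Algebra.IsUnramifiedIn (𝓞 L) v.asIdeal)
      (_hμu : μ.IsUnitary)
      (_hμω : ∀ x : ideleGroup ↥(maximalRealSubfield L), μ (AdeleRing.ideleBaseChange ↥(maximalRealSubfield L) L x) = quadraticHeckeCharCM L x)
      (_h2 : ¬ IsUnit (2 : 𝒪[w.1.adicCompletion L]))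
      [MeasurableSpace ((UnitaryGroup.cmDatum L 3 (Matrix.of fun i j : Fin 3 => if i.val + j.val + 1 = 3 then (1 : L) else 0)).Local v)] [BorelSpace ((UnitaryGroup.cmDatum L 3 (Matrix.of fun i j : Fin 3 => if i.val + j.val + 1 = 3 then (1 : L) else 0)).Local v)]
      [∀ γ : ((UnitaryGroup.cmDatum L 3 (Matrix.of fun i j : Fin 3 => if i.val + j.val + 1 = 3 then (1 : L) else 0)).Local v), MeasurableSpace (((UnitaryGroup.cmDatum L 3 (Matrix.of fun i j : Fin 3 => if i.val + j.val + 1 = 3 then (1 : L) else 0)).Local v) ⧸ Subgroup.centralizer ({γ} : Set ((UnitaryGroup.cmDatum L 3 (Matrix.of fun i j : Fin 3 => if i.val + j.val + 1 = 3 then (1 : L) else 0)).Local v)))]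
      [∀ γ : ((UnitaryGroup.cmDatum L 3 (Matrix.of fun i j : Fin 3 => if i.val + j.val + 1 = 3 then (1 : L) else 0)).Local v), BorelSpace (((UnitaryGroup.cmDatum L 3 (Matrix.of fun i j : Fin 3 => if i.val + j.val + 1 = 3 then (1 : L) else 0)).Local v) ⧸ Subgroup.centralizer ({γ} : Set ((UnitaryGroup.cmDatum L 3 (Matrix.of fun i j : Fin 3 => if i.val + j.val + 1 = 3 then (1 : L) else 0)).Local v)))]
      [MeasurableSpace ((UnitaryGroup.cmDatum L 2 (Matrix.of fun i j : Fin 2 => if i.val + j.val + 1 = 2 then (1 : L) else 0)).Local v × (UnitaryGroup.cmDatum L 1 (Matrix.of fun i j : Fin 1 => if i.val + j.val + 1 = 1 then (1 : L) else 0)).Local v)] [BorelSpace ((UnitaryGroup.cmDatum L 2 (Matrix.of fun i j : Fin 2 => if i.val + j.val + 1 = 2 then (1 : L) else 0)).Local v × (UnitaryGroup.cmDatum L 1 (Matrix.of fun i j : Fin 1 => if i.val + j.val + 1 = 1 then (1 : L) else 0)).Local v)]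
      [∀ a : ((UnitaryGroup.cmDatum L 2 (Matrix.of fun i j : Fin 2 => if i.val + j.val + 1 = 2 then (1 : L) else 0)).Local v × (UnitaryGroup.cmDatum L 1 (Matrix.of fun i j : Fin 1 => if i.val + j.val + 1 = 1 then (1 : L) else 0)).Local v), MeasurableSpace (((UnitaryGroup.cmDatum L 2 (Matrix.of fun i j : Fin 2 => if i.val + j.val + 1 = 2 then (1 : L) else 0)).Local v × (UnitaryGroup.cmDatum L 1 (Matrix.of fun i j : Fin 1 => if i.val + j.val + 1 = 1 then (1 : L) else 0)).Local v) ⧸ Subgroup.centralizer ({a} : Set ((UnitaryGroup.cmDatum L 2 (Matrix.of fun i j : Fin 2 => if i.val + j.val + 1 = 2 then (1 : L) else 0)).Local v × (UnitaryGroup.cmDatum L 1 (Matrix.of fun i j : Fin 1 => if i.val + j.val + 1 = 1 then (1 : L) else 0)).Local v)))]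
      [∀ a : ((UnitaryGroup.cmDatum L 2 (Matrix.of fun i j : Fin 2 => if i.val + j.val + 1 = 2 then (1 : L) else 0)).Local v × (UnitaryGroup.cmDatum L 1 (Matrix.of fun i j : Fin 1 => if i.val + j.val + 1 = 1 then (1 : L) else 0)).Local v), BorelSpace (((UnitaryGroup.cmDatum L 2 (Matrix.of fun i j : Fin 2 => if i.val + j.val + 1 = 2 then (1 : L) else 0)).Local v × (UnitaryGroup.cmDatum L 1 (Matrix.of fun i j : Fin 1 => if i.val + j.val + 1 = 1 then (1 : L) else 0)).Local v) ⧸ Subgroup.centralizer ({a} : Set ((UnitaryGroup.cmDatum L 2 (Matrix.of fun i j : Fin 2 => if i.val + j.val + 1 = 2 then (1 : L) else 0)).Local v × (UnitaryGroup.cmDatum L 1 (Matrix.of fun i j : Fin 1 => if i.val + j.val + 1 = 1 then (1 : L) else 0)).Local v)))]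
      (νH : Measure ((UnitaryGroup.cmDatum L 2 (Matrix.of fun i j : Fin 2 => if i.val + j.val + 1 = 2 then (1 : L) else 0)).Local v × (UnitaryGroup.cmDatum L 1 (Matrix.of fun i j : Fin 1 => if i.val + j.val + 1 = 1 then (1 : L) else 0)).Local v)) [νH.IsHaarMeasure] [νH.IsMulRightInvariant]
      (νG₃ : Measure ((UnitaryGroup.cmDatum L 3 (Matrix.of fun i j : Fin 3 => if i.val + j.val + 1 = 3 then (1 : L) else 0)).Local v)) [νG₃.IsHaarMeasure] [νG₃.IsMulRightInvariant]
      {mH : OrbitalMeasureFamily ((UnitaryGroup.cmDatum L 2 (Matrix.of fun i j : Fin 2 => if i.val + j.val + 1 = 2 then (1 : L) else 0)).Local v × (UnitaryGroup.cmDatum L 1 (Matrix.of fun i j : Fin 1 => if i.val + j.val + 1 = 1 then (1 : L) else 0)).Local v)} {mG₃ : OrbitalMeasureFamily ((UnitaryGroup.cmDatum L 3 (Matrix.of fun i j : Fin 3 => if i.val + j.val + 1 = 3 then (1 : L) else 0)).Local v)},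
      mH.IsCanonical (IsLocalGRegular L v) νH → mG₃.IsCanonical (fun γ => IsRegularElt (γ.val : GL (Fin 3) (UnitaryGroup.LocalRing L v))) νG₃ →
      ShalikaGermExpansionNonsplit L (Matrix.of fun i j : Fin 3 => if i.val + j.val + 1 = 3 then (1 : L) else 0) v →
      ∀ (φ₃ : ((UnitaryGroup.cmDatum L 3 (Matrix.of fun i j : Fin 3 => if i.val + j.val + 1 = 3 then (1 : L) else 0)).Local v) → ℂ), IsLocSmooth φ₃ →
        ∃ V ∈ 𝓝 (1 : ((UnitaryGroup.cmDatum L 2 (Matrix.of fun i j : Fin 2 => if i.val + j.val + 1 = 2 then (1 : L) else 0)).Local v × (UnitaryGroup.cmDatum L 1 (Matrix.of fun i j : Fin 1 => if i.val + j.val + 1 = 1 then (1 : L) else 0)).Local v)), ∃ φH : ((UnitaryGroup.cmDatum L 2 (Matrix.of fun i j : Fin 2 => if i.val + j.val + 1 = 2 then (1 : L) else 0)).Local v × (UnitaryGroup.cmDatum L 1 (Matrix.of fun i j : Fin 1 => if i.val + j.val + 1 = 1 then (1 : L) else 0)).Local v) → ℂ, IsLocSmooth φH ∧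
          ∀ γH ∈ V, IsLocalGRegular L v γH →
            stableOrbitalIntegralRel (IsLocalStablyConjH L v) mH φH γH =
              ∑ᶠ c : ConjClasses ((UnitaryGroup.cmDatum L 3 (Matrix.of fun i j : Fin 3 => if i.val + j.val + 1 = 3 then (1 : L) else 0)).Local v), ((finExplicitCollection L (Matrix.of fun i j : Fin 3 => if i.val + j.val + 1 = 3 then (1 : L) else 0) μ (finExplicitDelta_conj_left_all L (Matrix.of fun i j : Fin 3 => if i.val + j.val + 1 = 3 then (1 : L) else 0) μ) (finExplicitDelta_conj_right_all L (Matrix.of fun i j : Fin 3 => if i.val + j.val + 1 = 3 then (1 : L) else 0) μ)) v).Δ γH (Quotient.out c) * classOrbitalIntegral mG₃ φ₃ c)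
    (hram :
    ∀ (L : Type) [Field L] [NumberField L] [IsCMField L] (μ : HeckeCharacter L)
      {v : HeightOneSpectrum (𝓞 ↥(maximalRealSubfield L))} (w : UnitaryGroup.PlacesOver L v)
      (_hw : IsCMField.complexConj L • w.1 = w.1) (_he : v.asIdeal.ramificationIdx' w.1.asIdeal ≠ 1)
      (_hμu : μ.IsUnitary)
      (_hμω : ∀ x : ideleGroup ↥(maximalRealSubfield L), μ (AdeleRing.ideleBaseChange ↥(maximalRealSubfield L) L x) = quadraticHeckeCharCM L x)
      (_h2 : ¬ IsUnit (2 : 𝒪[w.1.adicCompletion L]))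
      [MeasurableSpace ((UnitaryGroup.cmDatum L 3 (Matrix.of fun i j : Fin 3 => if i.val + j.val + 1 = 3 then (1 : L) else 0)).Local v)] [BorelSpace ((UnitaryGroup.cmDatum L 3 (Matrix.of fun i j : Fin 3 => if i.val + j.val + 1 = 3 then (1 : L) else 0)).Local v)]
      [∀ γ : ((UnitaryGroup.cmDatum L 3 (Matrix.of fun i j : Fin 3 => if i.val + j.val + 1 = 3 then (1 : L) else 0)).Local v), MeasurableSpace (((UnitaryGroup.cmDatum L 3 (Matrix.of fun i j : Fin 3 => if i.val + j.val + 1 = 3 then (1 : L) else 0)).Local v) ⧸ Subgroup.centralizer ({γ} : Set ((UnitaryGroup.cmDatum L 3 (Matrix.of fun i j : Fin 3 => if i.val + j.val + 1 = 3 then (1 : L) else 0)).Local v)))]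
      [∀ γ : ((UnitaryGroup.cmDatum L 3 (Matrix.of fun i j : Fin 3 => if i.val + j.val + 1 = 3 then (1 : L) else 0)).Local v), BorelSpace (((UnitaryGroup.cmDatum L 3 (Matrix.of fun i j : Fin 3 => if i.val + j.val + 1 = 3 then (1 : L) else 0)).Local v) ⧸ Subgroup.centralizer ({γ} : Set ((UnitaryGroup.cmDatum L 3 (Matrix.of fun i j : Fin 3 => if i.val + j.val + 1 = 3 then (1 : L) else 0)).Local v)))]
      [MeasurableSpace ((UnitaryGroup.cmDatum L 2 (Matrix.of fun i j : Fin 2 => if i.val + j.val + 1 = 2 then (1 : L) else 0)).Local v × (UnitaryGroup.cmDatum L 1 (Matrix.of fun i j : Fin 1 => if i.val + j.val + 1 = 1 then (1 : L) else 0)).Local v)] [BorelSpace ((UnitaryGroup.cmDatum L 2 (Matrix.of fun i j : Fin 2 => if i.val + j.val + 1 = 2 then (1 : L) else 0)).Local v × (UnitaryGroup.cmDatum L 1 (Matrix.of fun i j : Fin 1 => if i.val + j.val + 1 = 1 then (1 : L) else 0)).Local v)]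
      [∀ a : ((UnitaryGroup.cmDatum L 2 (Matrix.of fun i j : Fin 2 => if i.val + j.val + 1 = 2 then (1 : L) else 0)).Local v × (UnitaryGroup.cmDatum L 1 (Matrix.of fun i j : Fin 1 => if i.val + j.val + 1 = 1 then (1 : L) else 0)).Local v), MeasurableSpace (((UnitaryGroup.cmDatum L 2 (Matrix.of fun i j : Fin 2 => if i.val + j.val + 1 = 2 then (1 : L) else 0)).Local v × (UnitaryGroup.cmDatum L 1 (Matrix.of fun i j : Fin 1 => if i.val + j.val + 1 = 1 then (1 : L) else 0)).Local v) ⧸ Subgroup.centralizer ({a} : Set ((UnitaryGroup.cmDatum L 2 (Matrix.of fun i j : Fin 2 => if i.val + j.val + 1 = 2 then (1 : L) else 0)).Local v × (UnitaryGroup.cmDatum L 1 (Matrix.of fun i j : Fin 1 => if i.val + j.val + 1 = 1 then (1 : L) else 0)).Local v)))]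
      [∀ a : ((UnitaryGroup.cmDatum L 2 (Matrix.of fun i j : Fin 2 => if i.val + j.val + 1 = 2 then (1 : L) else 0)).Local v × (UnitaryGroup.cmDatum L 1 (Matrix.of fun i j : Fin 1 => if i.val + j.val + 1 = 1 then (1 : L) else 0)).Local v), BorelSpace (((UnitaryGroup.cmDatum L 2 (Matrix.of fun i j : Fin 2 => if i.val + j.val + 1 = 2 then (1 : L) else 0)).Local v × (UnitaryGroup.cmDatum L 1 (Matrix.of fun i j : Fin 1 => if i.val + j.val + 1 = 1 then (1 : L) else 0)).Local v) ⧸ Subgroup.centralizer ({a} : Set ((UnitaryGroup.cmDatum L 2 (Matrix.of fun i j : Fin 2 => if i.val + j.val + 1 = 2 then (1 : L) else 0)).Local v × (UnitaryGroup.cmDatum L 1 (Matrix.of fun i j : Fin 1 => if i.val + j.val + 1 = 1 then (1 : L) else 0)).Local v)))]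
      (νH : Measure ((UnitaryGroup.cmDatum L 2 (Matrix.of fun i j : Fin 2 => if i.val + j.val + 1 = 2 then (1 : L) else 0)).Local v × (UnitaryGroup.cmDatum L 1 (Matrix.of fun i j : Fin 1 => if i.val + j.val + 1 = 1 then (1 : L) else 0)).Local v)) [νH.IsHaarMeasure] [νH.IsMulRightInvariant]
      (νG₃ : Measure ((UnitaryGroup.cmDatum L 3 (Matrix.of fun i j : Fin 3 => if i.val + j.val + 1 = 3 then (1 : L) else 0)).Local v)) [νG₃.IsHaarMeasure] [νG₃.IsMulRightInvariant]
      {mH : OrbitalMeasureFamily ((UnitaryGroup.cmDatum L 2 (Matrix.of fun i j : Fin 2 => if i.val + j.val + 1 = 2 then (1 : L) else 0)).Local v × (UnitaryGroup.cmDatum L 1 (Matrix.of fun i j : Fin 1 => if i.val + j.val + 1 = 1 then (1 : L) else 0)).Local v)} {mG₃ : OrbitalMeasureFamily ((UnitaryGroup.cmDatum L 3 (Matrix.of fun i j : Fin 3 => if i.val + j.val + 1 = 3 then (1 : L) else 0)).Local v)},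
      mH.IsCanonical (IsLocalGRegular L v) νH → mG₃.IsCanonical (fun γ => IsRegularElt (γ.val : GL (Fin 3) (UnitaryGroup.LocalRing L v))) νG₃ →
      ShalikaGermExpansionNonsplit L (Matrix.of fun i j : Fin 3 => if i.val + j.val + 1 = 3 then (1 : L) else 0) v →
      ∀ (φ₃ : ((UnitaryGroup.cmDatum L 3 (Matrix.of fun i j : Fin 3 => if i.val + j.val + 1 = 3 then (1 : L) else 0)).Local v) → ℂ), IsLocSmooth φ₃ →
        ∃ V ∈ 𝓝 (1 : ((UnitaryGroup.cmDatum L 2 (Matrix.of fun i j : Fin 2 => if i.val + j.val + 1 = 2 then (1 : L) else 0)).Local v × (UnitaryGroup.cmDatum L 1 (Matrix.of fun i j : Fin 1 => if i.val + j.val + 1 = 1 then (1 : L) else 0)).Local v)), ∃ φH : ((UnitaryGroup.cmDatum L 2 (Matrix.of fun i j : Fin 2 => if i.val + j.val + 1 = 2 then (1 : L) else 0)).Local v × (UnitaryGroup.cmDatum L 1 (Matrix.of fun i j : Fin 1 => if i.val + j.val + 1 = 1 then (1 : L) else 0)).Local v) → ℂ, IsLocSmooth φH ∧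
          ∀ γH ∈ V, IsLocalGRegular L v γH →
            stableOrbitalIntegralRel (IsLocalStablyConjH L v) mH φH γH =
              ∑ᶠ c : ConjClasses ((UnitaryGroup.cmDatum L 3 (Matrix.of fun i j : Fin 3 => if i.val + j.val + 1 = 3 then (1 : L) else 0)).Local v), ((finExplicitCollection L (Matrix.of fun i j : Fin 3 => if i.val + j.val + 1 = 3 then (1 : L) else 0) μ (finExplicitDelta_conj_left_all L (Matrix.of fun i j : Fin 3 => if i.val + j.val + 1 = 3 then (1 : L) else 0) μ) (finExplicitDelta_conj_right_all L (Matrix.of fun i j : Fin 3 => if i.val + j.val + 1 = 3 then (1 : L) else 0) μ)) v).Δ γH (Quotient.out c) * classOrbitalIntegral mG₃ φ₃ c) :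
    Literature.NumberTheory.Rogawski1990.N6nsDyadicStatement := by
  refine n6nsDyadic_of_dyadicAntidiag ?_
  intro L _ _ _ μ v w hw hμu hμω h2 _ _ _ _ _ _ _ _ νH _ _ νG₃ _ _ mH mG₃ hmH hmG₃ φ₃ hφ₃
  -- `v` is non-split: `w` is the only place above it
  have hsub : Subsingleton (UnitaryGroup.PlacesOver L v) :=
    UnitaryGroup.PlacesOver.subsingleton_of_smul_eq (IsCMField.complexConj L) (IsCMField.complexConj_ne_one L) w hw
  -- inert∕ramified dichotomy at `v`; the Shalika germ expansion at the dyadic place is organ (D-SH), passed inline (★ p847670 pattern)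
  by_cases hv : Algebra.IsUnramifiedIn (𝓞 L) v.asIdeal
  · exact hunr L μ w hw hv hμu hμω h2 νH νG₃ hmH hmG₃ (hsh L v w hsub h2) φ₃ hφ₃
  · exact hram L μ w hw (ramificationIdx'_ne_one_of_not_isUnramifiedIn_of_subsingleton L hsub w hv) hμu hμω h2 νH νG₃ hmH hmG₃ (hsh L v w hsub h2) φ₃ hφ₃

/-- **`stub_N6nsDyadic_paid : N6nsDyadicStatement`** — THE PAID HEAD BY NAME (desk F0P3-plan (g14) 06:49:33Z): the row's TYPE ★ `Literature.NumberTheory.Rogawski1990.N6nsDyadicStatement`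
(p847938; socket = germ `F0_P3a_N6nsGerm` ED. 1.17 binder `hdy`, by `exact`), closed over the three organs.  `--axioms` = TRIO ∪ {sorryAx} through EXACTLY `stub_DyRamCore`
(ED. 4; `stub_DyShalika` proved at ED. 3, `stub_DyUnramCore` at ED. 4). [cite: Rogawski1990, §4.9 Prop. 4.9.1 (a) p. 55] -/
theorem stub_N6nsDyadic_paid : Literature.NumberTheory.Rogawski1990.N6nsDyadicStatement :=
  n6nsDyadic_of_organs stub_DyShalika stub_DyUnramCore stub_DyRamCore

end Summit.HodgeConjecture.HodgeConjecture.Cruxes.H413.F0P3cDyadicPaydown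

end
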